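/-
Copyright (c) 2026 the pub-hodgecm-mathlib formalisation cell (harness21).  Prover seat hodgecm-mathlib-F0P3b-p01 (g11), 2026-09-01.  Road «S3-tree» (census «S3» v3, architect
A-p16 (g29) A-61∕A-65), brick T3′ «depth-zero κ-transfer», organ O8a-4 «COUNT TRANSPORT» of the holder's O8 sub-deal: the set A-p12 (g21)'s ★ `ResiduallyUnipotentFixedCosetCount`
lands on — self-dual lattices `Λ(u)`, `u ∈ U(σ, J)`, that are CYCLIC for `τ = P·diag(γ)·P⁻¹` — is in bijection (`Λ = P • M`) with ★ O8a-1's set of cyclic lattices `O[γ]·a` with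
`a` GOOD; hence the two counts agree and ★ O8a-1 `natCard_setOf_cyclicLattice_good_eq_relIndex` prices A-p12's `n₂(τ)`.
-/
import Literature.NumberTheory.Automorphic.SplitTorusOrderEigenframe          -- ★ O8a-3 (this seat): `span_range_transpose_eq_span_pow_mulVec`, `…_eq_map_span_pow_mul`, `formCongr_mul_diagonal_vandermonde`, `isIntegralMatrix_gram_and_valuation_det_iff_good`
import Literature.NumberTheory.Automorphic.FixedCosetsStableLattices         -- ★ `span_range_transpose_eq_iff` (brings ★ L1 `UnitaryGroupSelfDualLocus`: `exists_mem_unitaryGroupOfForm_mul_iff`)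
import HarnessLib

/-!
# Count transport: self-dual `τ`-cyclic lattices `Λ(u)` ↔ cyclic lattices `O[γ]·a` with `a` GOOD (`Λ = P • M`)

Topic `NumberTheory/Automorphic`; namespace `Literature.NumberTheory.Automorphic`.  THEOREMS ONLY (no definition, no instance, no notation, no named fact, no `sorry`); (D0) currency
`[Field E] [ValuativeRel E]`, `𝒪[E]`, ★ `glInt`, ★ `unitaryGroupOfForm`, ★ `formCongr`.  Cell `pub/hodgecm-mathlib`, crux H413 = `stmt-HodgeConjecture-24833`; road «S3-tree», brick T3′,
organ **O8a-4** (the last seam of O8a: A-p12's ★ `ncard_fixedBy_unitary_rank_eq_ncard_free` set ↔ ★ O8a-1's GOOD set).  HONEST LABEL: HC_CM is proved only modulo the cell's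
2 remaining named inputs (hLiu418, h413) until rung 0 closes; elementary algebra, asserts nothing printed.

THE MATHEMATICS.  `J ∈ GL_n(𝒪)` σ-hermitian, the ★ L1 hypotheses on `(E, σ, 𝒪)` (involution preserving `𝒪`, trace and norm surjectivity — «the self-dual locus is `U·GL_n(𝒪)`»),
`P ∈ GL_n(E)` an `h`-orthogonal eigenframe (`formCongr σ P J = diag(d)`), norm-one nodes `γ_i ∈ 𝒪` (`σγ_i = γ_i⁻¹`, units of `O[γ]`), `τ := P·diag(γ)·P⁻¹`.  Then `M ↦ P • M` is a
bijection from `{O[γ]·a | a GOOD}` (★ O8a-1's set: criterion vector `(d_i a_i σ(a_i) f′(γ_i))_i ∈ span_𝒪{γ^j}` with unit components) onto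
`{Λ | (∃ u ∈ U(σ,J), Λ = Λ(u)) ∧ ∃ w, Λ = span_𝒪 {τ^j *ᵥ w}}`: `P • (O[γ]·a) = Λ(P·diag(a)·V) = span{τ^j (P a)}` (★ O8a-3), and `Λ(g)` is some `Λ(u)` iff its Gram matrix
`formCongr σ g J` is unimodular (★ L1) iff — for `g = P·diag(a)·V`, Gram `= (σV)ᵀ diag(d a σa) V` (★ O8a-3) — `a` is GOOD (★ O8a-3); conversely a cyclic `Λ(u) = span{τ^j w}` has
`w = P a` with all `a_i ≠ 0` (else `P⁻¹u` would have a zero row).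
* §1 `apply_eq_zero_of_mem_span_pow_mul` (coordinate vanishing on `O[γ]·a` when `a_i = 0`), `forall_ne_zero_of_span_eq` (the zero-row argument);
* §2 `image_map_setOf_good_eq` (the bijection as an equality of sets) and **`ncard_setOf_selfDual_cyclic_eq_natCard_good`** (the two counts agree).

## References
* [Jacobowitz1962] R. Jacobowitz, *Hermitian forms over local fields*, Amer. J. Math. 84 (1962), §7 Thm. 7.1 (unimodular lattices: the self-dual locus).
* [Kottwitz1986] R. E. Kottwitz, *Base change for unit elements of Hecke algebras*, Compositio Math. 60 (1986), §3 (fixed cosets ↔ stable lattices).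
* [Rogawski1990] J. D. Rogawski, *Automorphic Representations of Unitary Groups in Three Variables* (1990), §4.9 Lemma 4.9.3 p. 56.
-/

set_option autoImplicit false

open Polynomial Finset Matrix
open scoped ValuativeRel Matrix MatrixGroups
open ValuativeRel

namespace Literature.NumberTheory.Automorphic

open Literature.NumberTheory.Automorphic.UnitaryGroup

variable {E : Type*} [Field E] [ValuativeRel E] {n : ℕ}

/-! ## §1 Cyclic vectors of a full lattice have non-zero eigen-coordinates -/

/-- If `a_{i₀} = 0`, every element of `span_𝒪 {γ^j • a}` has vanishing `i₀`-coordinate. [cite: Jacobowitz1962, §7] -/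
theorem apply_eq_zero_of_mem_span_pow_mul {γ a : Fin n → E} {i₀ : Fin n} (ha : a i₀ = 0) {x : Fin n → E}
    (hx : x ∈ Submodule.span 𝒪[E] (Set.range fun j : Fin n => fun i => γ i ^ (j : ℕ) * a i)) : x i₀ = 0 := by
  induction hx using Submodule.span_induction with
  | mem x hx => obtain ⟨j, rfl⟩ := hx; simp [ha]
  | zero => rfl
  | add x y _ _ hx hy => rw [Pi.add_apply, hx, hy, add_zero]
  | smul c x _ hx => rw [Pi.smul_apply, hx, smul_zero]

/-- **A full lattice `Λ(u)` which is `P • span_𝒪{γ^j • a}` has all `a_i ≠ 0`** (otherwise the `i`-th row of `P⁻¹u` vanishes). [cite: Jacobowitz1962, §7] [cite: Kottwitz1986, §3] -/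
theorem forall_ne_zero_of_span_eq (P u : GL (Fin n) E) {γ a : Fin n → E}
    (h : Submodule.span 𝒪[E] (Set.range ((u : Matrix (Fin n) (Fin n) E))ᵀ) =
      (Submodule.span 𝒪[E] (Set.range fun j : Fin n => fun i => γ i ^ (j : ℕ) * a i)).map
        ((Matrix.toLin' (P : Matrix (Fin n) (Fin n) E)).restrictScalars 𝒪[E])) :
    ∀ i, a i ≠ 0 := by
  intro i₀ ha
  -- every column of `u` is `P x` with `x_{i₀} = 0`, so the `i₀`-th row of `P⁻¹ u` is zero
  have hrow : ∀ j, (((P⁻¹ * u : GL (Fin n) E) : Matrix (Fin n) (Fin n) E)) i₀ j = 0 := by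
    intro j
    have hcol : ((u : Matrix (Fin n) (Fin n) E))ᵀ j ∈ Submodule.span 𝒪[E] (Set.range ((u : Matrix (Fin n) (Fin n) E))ᵀ) :=
      Submodule.subset_span ⟨j, rfl⟩
    rw [h, Submodule.mem_map] at hcol
    obtain ⟨x, hx, hxcol⟩ := hcol
    have hx0 : x i₀ = 0 := apply_eq_zero_of_mem_span_pow_mul ha hx
    have hcolP : ((P⁻¹ : GL (Fin n) E) : Matrix (Fin n) (Fin n) E) *ᵥ (((u : Matrix (Fin n) (Fin n) E))ᵀ j) = x := by
      rw [← hxcol, LinearMap.coe_restrictScalars, Matrix.toLin'_apply, mulVec_mulVec, ← Units.val_mul, inv_mul_cancel, Units.val_one, one_mulVec]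
    have : (((P⁻¹ * u : GL (Fin n) E) : Matrix (Fin n) (Fin n) E)) i₀ j =
        (((P⁻¹ : GL (Fin n) E) : Matrix (Fin n) (Fin n) E) *ᵥ (((u : Matrix (Fin n) (Fin n) E))ᵀ j)) i₀ := by
      rw [Units.val_mul, Matrix.mul_apply, mulVec, dotProduct]
      rfl
    rw [this, hcolP, hx0]
  have hdet : (((P⁻¹ * u : GL (Fin n) E) : Matrix (Fin n) (Fin n) E)).det = 0 := det_eq_zero_of_row_eq_zero i₀ hrow
  exact (Matrix.det_ne_zero_of_left_inverse (B := (((P⁻¹ * u)⁻¹ : GL (Fin n) E) : Matrix (Fin n) (Fin n) E))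
    (by rw [← Units.val_mul, inv_mul_cancel, Units.val_one])) hdet

/-! ## §2 The bijection `M ↦ P • M` and the equality of counts -/

/-- **THE IMAGE OF THE GOOD SET UNDER `M ↦ P • M` IS THE SET OF SELF-DUAL `τ`-CYCLIC LATTICES.**  See the module docstring. [cite: Jacobowitz1962, §7 Thm. 7.1] [cite: Kottwitz1986, §3]
[cite: Rogawski1990, §4.9 Lemma 4.9.3 p. 56] -/
theorem image_map_setOf_good_eq (σ : E →+* E) (hσσ : ∀ x, σ (σ x) = x) (hσO : ∀ x : 𝒪[E], σ x ∈ 𝒪[E])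
    (htr : ∃ b : 𝒪[E], (b : E) + σ b = 1) (hnorm : ∀ u : 𝒪[E], IsUnit u → σ u = u → ∃ t : 𝒪[E], (t : E) * σ t = u)
    (hσv : ∀ x, valuation E (σ x) = valuation E x)
    (J : GL (Fin n) E) (hJ : J ∈ glInt n E) (hJh : ((J : Matrix (Fin n) (Fin n) E).map σ)ᵀ = J)
    (P : GL (Fin n) E) (d : Fin n → E) (hP : formCongr σ P (J : Matrix (Fin n) (Fin n) E) = diagonal d)
    {γ : Fin n → E} (hγ : ∀ i, γ i ∈ 𝒪[E]) (hinj : Function.Injective γ) (hσγ : ∀ i, σ (γ i) = (γ i)⁻¹)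
    {r : (𝒪[E])[X]} (hr : ∀ i, (r.map (𝒪[E]).subtype).eval (γ i) * γ i = 1) :
    (fun M : Submodule 𝒪[E] (Fin n → E) => M.map ((Matrix.toLin' (P : Matrix (Fin n) (Fin n) E)).restrictScalars 𝒪[E])) ''
        {M | ∃ a : Fin n → E,
          ((fun i => d i * a i * σ (a i) * ∏ j ∈ univ.erase i, (γ i - γ j)) ∈ Submodule.span 𝒪[E] (Set.range fun j : Fin n => fun i => γ i ^ (j : ℕ)) ∧
            ∀ i, ∃ y ∈ 𝒪[E], y * (d i * a i * σ (a i) * ∏ j ∈ univ.erase i, (γ i - γ j)) = 1) ∧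
          M = Submodule.span 𝒪[E] (Set.range fun j : Fin n => fun i => γ i ^ (j : ℕ) * a i)} =
      {Λ | (∃ u ∈ unitaryGroupOfForm σ (J : Matrix (Fin n) (Fin n) E), Λ = Submodule.span 𝒪[E] (Set.range ((u : Matrix (Fin n) (Fin n) E))ᵀ)) ∧
        ∃ w : Fin n → E, Λ = Submodule.span 𝒪[E] (Set.range fun j : Fin n =>
          ((P : Matrix (Fin n) (Fin n) E) * diagonal γ * ((P⁻¹ : GL (Fin n) E) : Matrix (Fin n) (Fin n) E)) ^ (j : ℕ) *ᵥ w)} := by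
  classical
  -- the Gram matrix of `P · diag(a) · V` and its two readings
  have hgram : ∀ (a : Fin n → E) (Ma : GL (Fin n) E), (Ma : Matrix (Fin n) (Fin n) E) = diagonal a * vandermonde γ →
      formCongr σ (P * Ma) (J : Matrix (Fin n) (Fin n) E) = Matrix.of fun j k : Fin n => ∑ i, (d i * a i * σ (a i)) * σ (γ i) ^ (j : ℕ) * γ i ^ (k : ℕ) := by
    intro a Ma hMa
    rw [formCongr_mul_diagonal_vandermonde σ P (J : Matrix (Fin n) (Fin n) E) d hP a γ Ma hMa, gram_cyclic_eq]
  ext Λ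
  simp only [Set.mem_image, Set.mem_setOf_eq]
  constructor
  · -- a GOOD `a` gives a self-dual `τ`-cyclic lattice
    rintro ⟨M, ⟨a, ⟨hmem, hunit⟩, rfl⟩, rfl⟩
    have ha0 : ∀ i, a i ≠ 0 := fun i h0 => by
      obtain ⟨y, -, hy⟩ := hunit i
      rw [h0] at hy
      simp at hy
    have hdetMa : (diagonal a * vandermonde γ).det ≠ 0 := det_diagonal_mul_vandermonde_ne_zero ha0 hinj
    set Ma : GL (Fin n) E := Matrix.GeneralLinearGroup.mkOfDetNeZero _ hdetMa with hMa
    have hMaval : (Ma : Matrix (Fin n) (Fin n) E) = diagonal a * vandermonde γ := rfl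
    have hΛg : (Submodule.span 𝒪[E] (Set.range fun j : Fin n => fun i => γ i ^ (j : ℕ) * a i)).map
        ((Matrix.toLin' (P : Matrix (Fin n) (Fin n) E)).restrictScalars 𝒪[E]) =
        Submodule.span 𝒪[E] (Set.range (((P * Ma : GL (Fin n) E) : Matrix (Fin n) (Fin n) E))ᵀ) := by
      rw [Units.val_mul, hMaval, span_range_transpose_eq_map_span_pow_mul]
    refine ⟨?_, ⟨(P : Matrix (Fin n) (Fin n) E) *ᵥ a, ?_⟩⟩
    · -- unimodular Gram ⇒ `Λ(P·Ma) = Λ(u)`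
      obtain ⟨hint, hdet⟩ := (isIntegralMatrix_gram_and_valuation_det_iff_good σ hσv hγ hinj hσγ hr d a).2 ⟨hmem, hunit⟩
      rw [← hgram a Ma hMaval] at hint hdet
      have hdet0 : (formCongr σ (P * Ma) (J : Matrix (Fin n) (Fin n) E)).det ≠ 0 := fun h0 => by
        rw [h0, map_zero] at hdet; exact zero_ne_one hdet
      set J' : GL (Fin n) E := Matrix.GeneralLinearGroup.mkOfDetNeZero _ hdet0 with hJ'
      have hJ'val : (J' : Matrix (Fin n) (Fin n) E) = formCongr σ (P * Ma) (J : Matrix (Fin n) (Fin n) E) := rfl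
      have hJ'int : J' ∈ glInt n E := mem_glInt_of_isIntegralMatrix (by rw [hJ'val]; exact hint) (by rw [hJ'val]; exact hdet)
      obtain ⟨u, hu, k, hk, hgk⟩ := (exists_mem_unitaryGroupOfForm_mul_iff σ hσσ hσO htr hnorm J hJ hJh (P * Ma)).2 ⟨J', hJ'int, hJ'val⟩
      refine ⟨u, hu, ?_⟩
      rw [hΛg, eq_comm, span_range_transpose_eq_iff, hgk, inv_mul_cancel_left]
      exact hk
    · rw [hΛg, Units.val_mul, hMaval, span_range_transpose_eq_span_pow_mulVec]
  · -- a self-dual `τ`-cyclic lattice comes from a GOOD `a := P⁻¹ w`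
    rintro ⟨⟨u, hu, rfl⟩, ⟨w, hw⟩⟩
    set a : Fin n → E := ((P⁻¹ : GL (Fin n) E) : Matrix (Fin n) (Fin n) E) *ᵥ w with ha
    have hPa : (P : Matrix (Fin n) (Fin n) E) *ᵥ a = w := by
      rw [ha, mulVec_mulVec, ← Units.val_mul, mul_inv_cancel, Units.val_one, one_mulVec]
    have hmap : Submodule.span 𝒪[E] (Set.range ((u : Matrix (Fin n) (Fin n) E))ᵀ) =
        (Submodule.span 𝒪[E] (Set.range fun j : Fin n => fun i => γ i ^ (j : ℕ) * a i)).map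
          ((Matrix.toLin' (P : Matrix (Fin n) (Fin n) E)).restrictScalars 𝒪[E]) := by
      rw [hw, ← hPa, ← span_range_transpose_eq_span_pow_mulVec, span_range_transpose_eq_map_span_pow_mul]
    have ha0 : ∀ i, a i ≠ 0 := forall_ne_zero_of_span_eq P u hmap
    have hdetMa : (diagonal a * vandermonde γ).det ≠ 0 := det_diagonal_mul_vandermonde_ne_zero ha0 hinj
    set Ma : GL (Fin n) E := Matrix.GeneralLinearGroup.mkOfDetNeZero _ hdetMa with hMa
    have hMaval : (Ma : Matrix (Fin n) (Fin n) E) = diagonal a * vandermonde γ := rfl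
    have hΛg : Submodule.span 𝒪[E] (Set.range ((u : Matrix (Fin n) (Fin n) E))ᵀ) =
        Submodule.span 𝒪[E] (Set.range (((P * Ma : GL (Fin n) E) : Matrix (Fin n) (Fin n) E))ᵀ) := by
      rw [hmap, Units.val_mul, hMaval, span_range_transpose_eq_map_span_pow_mul]
    -- `Λ(u) = Λ(P·Ma)` ⇒ `P·Ma = u·k`, `k ∈ GL_n(𝒪)` ⇒ the Gram matrix of `P·Ma` is unimodular ⇒ `a` GOOD
    have hk : u⁻¹ * (P * Ma) ∈ glInt n E := (span_range_transpose_eq_iff u (P * Ma)).1 hΛg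
    obtain ⟨J', hJ'int, hJ'val⟩ := (exists_mem_unitaryGroupOfForm_mul_iff σ hσσ hσO htr hnorm J hJ hJh (P * Ma)).1
      ⟨u, hu, u⁻¹ * (P * Ma), hk, by rw [mul_inv_cancel_left]⟩
    have hint : IsIntegralMatrix (formCongr σ (P * Ma) (J : Matrix (Fin n) (Fin n) E)) := by
      rw [← hJ'val]; exact isIntegralMatrix_of_mem_glInt hJ'int
    have hdet : valuation E (formCongr σ (P * Ma) (J : Matrix (Fin n) (Fin n) E)).det = 1 := by
      rw [← hJ'val]; exact valuation_det_eq_one_of_mem_glInt hJ'int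
    rw [hgram a Ma hMaval] at hint hdet
    obtain ⟨hmem, hunit⟩ := (isIntegralMatrix_gram_and_valuation_det_iff_good σ hσv hγ hinj hσγ hr d a).1 ⟨hint, hdet⟩
    exact ⟨Submodule.span 𝒪[E] (Set.range fun j : Fin n => fun i => γ i ^ (j : ℕ) * a i), ⟨a, ⟨hmem, hunit⟩, rfl⟩, hmap.symm⟩

/-- **COUNT TRANSPORT: `#{Λ(u) self-dual, τ-cyclic} = #{O[γ]·a : a GOOD}`** (the right side is priced by ★ O8a-1 `natCard_setOf_cyclicLattice_good_eq_relIndex` as `[C : O[γ]^×]`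
on the parity class). [cite: Jacobowitz1962, §7 Thm. 7.1] [cite: Kottwitz1986, §3] [cite: Rogawski1990, §4.9 Lemma 4.9.3 p. 56] -/
theorem ncard_setOf_selfDual_cyclic_eq_natCard_good (σ : E →+* E) (hσσ : ∀ x, σ (σ x) = x) (hσO : ∀ x : 𝒪[E], σ x ∈ 𝒪[E])
    (htr : ∃ b : 𝒪[E], (b : E) + σ b = 1) (hnorm : ∀ u : 𝒪[E], IsUnit u → σ u = u → ∃ t : 𝒪[E], (t : E) * σ t = u)
    (hσv : ∀ x, valuation E (σ x) = valuation E x)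
    (J : GL (Fin n) E) (hJ : J ∈ glInt n E) (hJh : ((J : Matrix (Fin n) (Fin n) E).map σ)ᵀ = J)
    (P : GL (Fin n) E) (d : Fin n → E) (hP : formCongr σ P (J : Matrix (Fin n) (Fin n) E) = diagonal d)
    {γ : Fin n → E} (hγ : ∀ i, γ i ∈ 𝒪[E]) (hinj : Function.Injective γ) (hσγ : ∀ i, σ (γ i) = (γ i)⁻¹)
    {r : (𝒪[E])[X]} (hr : ∀ i, (r.map (𝒪[E]).subtype).eval (γ i) * γ i = 1) :
    {Λ : Submodule 𝒪[E] (Fin n → E) |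
        (∃ u ∈ unitaryGroupOfForm σ (J : Matrix (Fin n) (Fin n) E), Λ = Submodule.span 𝒪[E] (Set.range ((u : Matrix (Fin n) (Fin n) E))ᵀ)) ∧
        ∃ w : Fin n → E, Λ = Submodule.span 𝒪[E] (Set.range fun j : Fin n =>
          ((P : Matrix (Fin n) (Fin n) E) * diagonal γ * ((P⁻¹ : GL (Fin n) E) : Matrix (Fin n) (Fin n) E)) ^ (j : ℕ) *ᵥ w)}.ncard =
      Nat.card {M : Submodule 𝒪[E] (Fin n → E) //
        ∃ a : Fin n → E,
          ((fun i => d i * a i * σ (a i) * ∏ j ∈ univ.erase i, (γ i - γ j)) ∈ Submodule.span 𝒪[E] (Set.range fun j : Fin n => fun i => γ i ^ (j : ℕ)) ∧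
            ∀ i, ∃ y ∈ 𝒪[E], y * (d i * a i * σ (a i) * ∏ j ∈ univ.erase i, (γ i - γ j)) = 1) ∧
          M = Submodule.span 𝒪[E] (Set.range fun j : Fin n => fun i => γ i ^ (j : ℕ) * a i)} := by
  -- `M ↦ P • M` is injective (`toLin' P` is)
  have hinjmap : Function.Injective (fun M : Submodule 𝒪[E] (Fin n → E) => M.map ((Matrix.toLin' (P : Matrix (Fin n) (Fin n) E)).restrictScalars 𝒪[E])) := by
    refine Submodule.map_injective_of_injective ?_
    intro x y hxy
    have h := congrArg (fun z => ((P⁻¹ : GL (Fin n) E) : Matrix (Fin n) (Fin n) E) *ᵥ z) hxy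
    simpa only [LinearMap.coe_restrictScalars, Matrix.toLin'_apply, mulVec_mulVec, ← Units.val_mul, inv_mul_cancel, Units.val_one, one_mulVec] using h
  rw [← image_map_setOf_good_eq σ hσσ hσO htr hnorm hσv J hJ hJh P d hP hγ hinj hσγ hr, Set.ncard_image_of_injective _ hinjmap]
  exact (Nat.card_coe_set_eq _).symm

end Literature.NumberTheory.Automorphic
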